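import Summits.CriticalPhenomena.PercolationContinuityZ3.Theorems.PercNearOneGluingNoHeavyPcintLoopExclusionLaw
import Literature.Probability.FitznerVanDerHofstad2017.NbwCountExact
import HarnessLib

/-!
# CriticalPhenomena/PercolationContinuityZ3 — Theorems/PercNearOneGluingNoHeavyPcintLoopExclusionFirstRungs.lean: the first two rungs of the memory hierarchy in closed form — `μ_0 = 2d`, `μ_2 = 2d − 1`, `μ_4 < 2d − 1` — and the PROVED instance `R_4(d) > 0` of STRUCTURE CONJ C4 (a)

Lane prim-pcint, STRUCTURE rule; companion of …PcintLoopExclusionLaw (C4 typed).  Clause (a) of C4 asserts `0 < R_τ(d) < 1`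
for every `d ≥ 2` and even `τ ≥ 4`; its lower half is the STRICT monotonicity `μ_τ(d) < μ_{τ−2}(d)` of the memory
hierarchy, open in general (a Kesten-pattern statement for finite-memory walks).  This file proves the FIRST instance for
every dimension, `Δ_4(d) = ln(μ_2(d)/μ_4(d)) > 0`, from two closed forms and one printed bound:

* `memWords_two_eq_nbwWords`, **`memCount_two_eq` : `c_{n,2}(d) = 2d(2d−1)^{n−1}`** (memory `2` = no immediate reversal;
  Madras–Slade §1.2 below (1.2.13); count = the tree's `card_nbwWords_eq`), whence **`memGrowth_two_eq` : `μ_2(d) = 2d − 1`**;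
  also `memGrowth_zero_eq` : `μ_0(d) = 2d` (no constraint) — so the typed rung cost `Δ_2(d) = ln(2d/(2d−1))` in closed form
  (`memLoopCost_two_eq`), `closingCount_two` (`= 2d`), `loopCompat_two_eq` : **`R_2(d) = 2d·ln(2d/(2d−1))`** and
  `one_lt_loopCompat_two` : **`R_2(d) > 1`** — the degenerate reversal "rung" violates the window, which is why C4 (a) starts at τ = 4;
* `isMemFour_of_isMem_four` (memory `4` ⇒ no reversal and no unit square), `memCount_four_le` : `c_{3m+r,4} ≤ (2d)^r Λ_d^m`,
  `Λ_d = (2d−1)³ − 1` (the tree's three-step block bound `card_memFourWords_le`, printed in BDGS 2012 App. A.1 (A.4)), whence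
  **`memGrowth_four_pow_three_le` : `μ_4(d)³ ≤ (2d−1)³ − 1`** and **`memGrowth_four_lt` : `μ_4(d) < 2d − 1 = μ_2(d)`** (`d ≥ 2`);
* **`memLoopCost_four_pos` : `Δ_4(d) > 0`** and **`loopCompat_four_pos` : `R_4(d) > 0`** for every `d ≥ 2` — the first rung
  of the lower inequality of C4 (a), PROVED (the upper inequality `R_4 < 1` and all higher rungs remain conjectural; the
  lane's numbers: `R_4(d) = 0.586, 0.715, 0.780, 0.820, 0.848` for `d = 2..6`).

HONEST FRAMING: elementary (the memory-2 and memory-4 counts are classical: Madras–Slade (1.2.13)–(1.2.14), Fisher–Sykes 1959);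
new to the tree only as statements about the typed objects `memGrowth` / `memLoopCost` / `loopCompat`.  Nothing here is used
by a certified `p_c` cell.  Written by prim-pcint-2 gen 16 (prover-prim-pcint-2-g16-0), 2026-08-24.
-/

noncomputable section

open Filter Topology
open Literature.Probability.LatticeModels Literature.Probability.Percolation
open Literature.Probability.RandomPlanarGeometry.SAW.Zd (connectiveConstant connectiveConstant_pos count)
open Summit.CriticalPhenomena.PercolationContinuityZ3.Theorems.Pcint

namespace Summit.CriticalPhenomena.PercolationContinuityZ3.Theorems.Pcint.MemoryTail

variable {d : ℕ}

/-! ### `μ_τ^n ≤ c_{n,τ}` -/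

/-- `μ_τ(d)^{n+1} ≤ c_{n+1,τ}(d)` (the infimum form of `μ_τ`). [cite: MadrasSlade1993, §1.2 (1.2.12)] -/
theorem pow_memGrowth_le_memCount (d τ n : ℕ) : memGrowth d τ ^ (n + 1) ≤ memCount d τ (n + 1) := by
  have h := memGrowth_le_memCount_rpow d τ n
  have h2 := pow_le_pow_left₀ (memGrowth_nonneg d τ) h (n + 1)
  rwa [← Real.rpow_natCast ((memCount d τ (n + 1) : ℝ) ^ (1 / ((n : ℝ) + 1))), ← Real.rpow_mul (Nat.cast_nonneg _),
    show (1 / ((n : ℝ) + 1)) * ((n + 1 : ℕ) : ℝ) = 1 by push_cast; field_simp, Real.rpow_one] at h2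

/-! ### Memory 0 and memory 2 in closed form -/

/-- Memory `0` is no constraint: every step word has memory `0`. [folklore] -/
theorem memWords_zero_eq_univ (d n : ℕ) : memWords d 0 n = Finset.univ := by
  classical
  ext w
  simp only [mem_memWords, Finset.mem_univ, iff_true]
  intro i j _ hij hτ
  omega

/-- `c_{n,0}(d) = (2d)^n`. [folklore] -/
theorem memCount_zero_eq (d n : ℕ) : memCount d 0 n = (2 * d) ^ n := by
  classical
  unfold memCount
  rw [memWords_zero_eq_univ]
  simp [Finset.card_univ, Fintype.card_prod, mul_comm]

/-- **`μ_0(d) = 2d`.** [folklore] -/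
theorem memGrowth_zero_eq (d : ℕ) : memGrowth d 0 = 2 * d := by
  unfold memGrowth
  have h : ∀ n : ℕ, ((memCount d 0 (n + 1) : ℕ) : ℝ) ^ (1 / ((n : ℝ) + 1)) = 2 * d := fun n => by
    rw [memCount_zero_eq, Nat.cast_pow, show (1 / ((n : ℝ) + 1)) = ((n + 1 : ℕ) : ℝ)⁻¹ by push_cast; ring,
      Real.pow_rpow_inv_natCast (by positivity) (by omega)]
    push_cast; ring
  simp_rw [h]
  exact ciInf_const

/-- Memory `2` words are the non-backtracking words. [cite: MadrasSlade1993, §1.2 (memory τ = 2 rules out immediate reversals)] -/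
theorem isNBW_of_isMem_two {n : ℕ} {w : Fin n → Fin d × Bool} (h : IsMem 2 w) : IsNBW w :=
  fun k hk hrev => h k (k + 2) (by omega) (by omega) (by omega) (wordPos_add_two_of_srev w hk hrev).symm

/-- Non-backtracking words have memory `2` (consecutive sites differ by a unit step; sites two steps apart coincide only
after an immediate reversal, by injectivity of `stepVec`). [cite: MadrasSlade1993, §1.2 (memory τ = 2 rules out immediate reversals)] -/
theorem isMem_two_of_isNBW {n : ℕ} {w : Fin n → Fin d × Bool} (h : IsNBW w) : IsMem 2 w := by
  intro i j hj hij hτ heq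
  rcases (by omega : j = i + 1 ∨ j = i + 2) with rfl | rfl
  · rw [wordPos_succ w (by omega)] at heq
    have h0 : stepVec (w ⟨i, by omega⟩) = 0 := (left_eq_add.mp heq)
    have h1 := l1_stepVec (w ⟨i, by omega⟩)
    rw [h0] at h1
    simp [l1] at h1
  · rw [show i + 2 = (i + 1) + 1 from rfl, wordPos_succ w (by omega), wordPos_succ w (by omega), add_assoc] at heq
    have h0 : stepVec (w ⟨i, by omega⟩) + stepVec (w ⟨i + 1, by omega⟩) = 0 := (left_eq_add.mp heq)
    have h1 : stepVec (w ⟨i + 1, by omega⟩) = stepVec (srev (w ⟨i, by omega⟩)) := by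
      rw [stepVec_srev]; exact eq_neg_of_add_eq_zero_right h0
    exact h i (by omega) (GMStep.stepVec_injective d h1)

/-- `memWords d 2 n = nbwWords d n`. [cite: MadrasSlade1993, §1.2 (1.2.13)] -/
theorem memWords_two_eq_nbwWords (d n : ℕ) : memWords d 2 n = nbwWords d n := by
  classical
  ext w
  rw [mem_memWords, mem_nbwWords]
  exact ⟨isNBW_of_isMem_two, isMem_two_of_isNBW⟩

/-- **`c_{n,2}(d) = 2d(2d−1)^{n−1}`** (`n ≥ 1`). [cite: MadrasSlade1993, §1.2, below (1.2.13) (c_{N,2} = 2d(2d−1)^{N−1})] -/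
theorem memCount_two_eq (d : ℕ) {n : ℕ} (hn : 1 ≤ n) : memCount d 2 n = 2 * d * (2 * d - 1) ^ (n - 1) := by
  unfold memCount
  rw [memWords_two_eq_nbwWords, Literature.Probability.FitznerVanDerHofstad2017.card_nbwWords_eq d hn]

/-- The real form of the count: `c_{n+1,2}(d) = 2d(2d−1)^n` (`d ≥ 1`). [cite: MadrasSlade1993, §1.2, below (1.2.13)] -/
theorem cast_memCount_two [NeZero d] (n : ℕ) :
    ((memCount d 2 (n + 1) : ℕ) : ℝ) = 2 * d * (2 * (d : ℝ) - 1) ^ n := by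
  rw [memCount_two_eq d (by omega), show n + 1 - 1 = n by omega, Nat.cast_mul, Nat.cast_pow,
    Nat.cast_sub (by have := NeZero.one_le (n := d); omega), Nat.cast_mul]
  push_cast; ring

/-- `2d − 1 ≤ μ_2(d)` (each term of the infimum is `(2d(2d−1)^n)^{1/(n+1)} ≥ 2d − 1`). [cite: MadrasSlade1993, §1.2 (1.2.13)] -/
theorem two_mul_sub_one_le_memGrowth_two [NeZero d] : 2 * (d : ℝ) - 1 ≤ memGrowth d 2 := by
  have hd1 : (1 : ℝ) ≤ d := by exact_mod_cast NeZero.one_le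
  have hx : (0 : ℝ) ≤ 2 * d - 1 := by linarith
  refine le_ciInf fun n => ?_
  have hcnt : (2 * (d : ℝ) - 1) ^ (n + 1) ≤ (memCount d 2 (n + 1) : ℝ) := by
    rw [cast_memCount_two, pow_succ]
    have hp := pow_nonneg hx n
    nlinarith
  calc 2 * (d : ℝ) - 1 = ((2 * (d : ℝ) - 1) ^ (n + 1)) ^ (1 / ((n : ℝ) + 1)) := by
        rw [show (1 / ((n : ℝ) + 1)) = ((n + 1 : ℕ) : ℝ)⁻¹ by push_cast; ring,
          Real.pow_rpow_inv_natCast hx (by omega)]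
    _ ≤ _ := Real.rpow_le_rpow (pow_nonneg hx _) hcnt (by positivity)

/-- `μ_2(d) ≤ 2d − 1` (the terms `(2d(2d−1)^n)^{1/(n+1)} = (2d/(2d−1))^{1/(n+1)} (2d−1)` tend to `2d − 1`).
[cite: MadrasSlade1993, §1.2 (1.2.13)] -/
theorem memGrowth_two_le [NeZero d] : memGrowth d 2 ≤ 2 * (d : ℝ) - 1 := by
  have hd1 : (1 : ℝ) ≤ d := by exact_mod_cast NeZero.one_le
  have hx : (0 : ℝ) < 2 * d - 1 := by linarith
  set c : ℝ := 2 * d / (2 * d - 1) with hc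
  have hcpos : 0 < c := div_pos (by linarith) hx
  -- the n-th term equals c^{1/(n+1)} · (2d − 1)
  have hterm : ∀ n : ℕ, ((memCount d 2 (n + 1) : ℕ) : ℝ) ^ (1 / ((n : ℝ) + 1)) = c ^ (1 / ((n : ℝ) + 1)) * (2 * d - 1) :=
    fun n => by
    rw [cast_memCount_two, show 2 * (d : ℝ) * (2 * d - 1) ^ n = c * (2 * d - 1) ^ (n + 1) by
      rw [hc, pow_succ]; field_simp, Real.mul_rpow hcpos.le (pow_nonneg hx.le _),
      show (1 / ((n : ℝ) + 1)) = ((n + 1 : ℕ) : ℝ)⁻¹ by push_cast; ring, Real.pow_rpow_inv_natCast hx.le (by omega)]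
  have hlim : Tendsto (fun n : ℕ => ((memCount d 2 (n + 1) : ℕ) : ℝ) ^ (1 / ((n : ℝ) + 1))) atTop
      (𝓝 (2 * d - 1)) := by
    simp_rw [hterm]
    have h1 : Tendsto (fun n : ℕ => c ^ (1 / ((n : ℝ) + 1))) atTop (𝓝 1) := by
      have h0 : ContinuousAt (fun x : ℝ => c ^ x) 0 := Real.continuousAt_const_rpow hcpos.ne'
      have := h0.tendsto.comp (tendsto_one_div_add_atTop_nhds_zero_nat (𝕜 := ℝ))
      simpa [Real.rpow_zero, Function.comp_def] using this
    simpa using h1.mul_const (2 * (d : ℝ) - 1)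
  exact ge_of_tendsto' hlim fun n => memGrowth_le_memCount_rpow d 2 n

/-- **`μ_2(d) = 2d − 1`**: the memory-2 (non-reversing) growth constant in closed form (`d ≥ 1`). [cite: MadrasSlade1993, §1.2 (1.2.13)] -/
theorem memGrowth_two_eq [NeZero d] : memGrowth d 2 = 2 * (d : ℝ) - 1 :=
  le_antisymm memGrowth_two_le two_mul_sub_one_le_memGrowth_two

/-- The typed rung cost `Δ_2(d) = ln(2d/(2d−1))` in closed form (`d ≥ 1`). [folklore] -/
theorem memLoopCost_two_eq [NeZero d] : memLoopCost d 2 = Real.log (2 * d / (2 * (d : ℝ) - 1)) := by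
  unfold memLoopCost
  rw [show (2 : ℕ) - 2 = 0 from rfl, memGrowth_zero_eq, memGrowth_two_eq]

/-! ### The degenerate rung `τ = 2`: `R_2(d) = 2d·ln(2d/(2d−1)) > 1` -/

/-- `closingCount d 2 = 2d`: every 1-step word "closes" (its end is a neighbour of the start). [folklore] -/
theorem closingCount_two (d : ℕ) : closingCount d 2 = 2 * d := by
  classical
  unfold closingCount
  rw [show 2 - 1 = 1 from rfl]
  have h : nearWords d 2 1 = Finset.univ := by
    ext w
    simp only [Finset.mem_univ, iff_true]
    unfold nearWords
    rw [Finset.mem_filter, mem_sawWords]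
    have h1 : wordPos w 1 = stepVec (w ⟨0, by omega⟩) := by
      simpa using wordPos_succ w (k := 0) (by omega)
    have hne : wordPos w 1 ≠ wordPos w 0 := by
      rw [h1, wordPos_zero]
      intro h0
      have := l1_stepVec (w ⟨0, by omega⟩)
      rw [h0] at this
      simp [l1] at this
    refine ⟨fun i j hi hj hij => ?_, ?_⟩
    · interval_cases i <;> interval_cases j <;>
        first | rfl | exact absurd hij hne | exact absurd hij.symm hne
    · rw [h1, l1_stepVec]
  rw [h, Finset.card_univ]
  simp [Fintype.card_prod, mul_comm]

/-- `f_2(d) = 2d/μ_0² = 1/(2d)` (`d ≥ 1`). [folklore] -/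
theorem memLoopDensity_two_eq [NeZero d] : memLoopDensity d 2 = 1 / (2 * d) := by
  unfold memLoopDensity
  rw [show (2 : ℕ) - 2 = 0 from rfl, memGrowth_zero_eq, closingCount_two]
  have hd : (0 : ℝ) < d := by exact_mod_cast Nat.pos_of_ne_zero (NeZero.ne d)
  push_cast
  field_simp

/-- **`R_2(d) = 2d · ln(2d/(2d−1))`** in closed form (`d ≥ 1`). [folklore] -/
theorem loopCompat_two_eq [NeZero d] : loopCompat d 2 = 2 * d * Real.log (2 * d / (2 * (d : ℝ) - 1)) := by
  unfold loopCompat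
  rw [memLoopCost_two_eq, memLoopDensity_two_eq]
  have hd : (0 : ℝ) < d := by exact_mod_cast Nat.pos_of_ne_zero (NeZero.ne d)
  field_simp

/-- **`R_2(d) > 1`** for every `d ≥ 1` (`ln(1+x) > x/(1+x)`): the degenerate `τ = 2` "rung" (the exclusion of immediate
reversals, which is not a loop effect) violates the window `R < 1` — which is why clause (a) of C4 starts at `τ = 4`
(`loopCompatWindow` quantifies `m ≥ 2`).  Numerically `R_2 = 1.216, 1.094, 1.062` for `d = 2, 3, 4`. [folklore] -/
theorem one_lt_loopCompat_two [NeZero d] : 1 < loopCompat d 2 := by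
  rw [loopCompat_two_eq]
  have hd1 : (1 : ℝ) ≤ d := by exact_mod_cast NeZero.one_le
  have h2d : (0 : ℝ) < 2 * d := by linarith
  have h2d1 : (0 : ℝ) < 2 * d - 1 := by linarith
  -- `log y < y − 1` at `y = (2d−1)/(2d) ≠ 1`
  have hlog := Real.log_lt_sub_one_of_pos (div_pos h2d1 h2d) (by rw [Ne, div_eq_one_iff_eq h2d.ne']; linarith)
  rw [Real.log_div h2d1.ne' h2d.ne'] at hlog
  rw [Real.log_div h2d.ne' h2d1.ne']
  have hsub : (2 * (d : ℝ) - 1) / (2 * d) - 1 = -(1 / (2 * d)) := by field_simp; ring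
  rw [hsub] at hlog
  -- `1/(2d) < log(2d) − log(2d−1)`, multiply by `2d`
  have hlt : 1 / (2 * (d : ℝ)) < Real.log (2 * d) - Real.log (2 * d - 1) := by linarith
  have := mul_lt_mul_of_pos_left hlt h2d
  rwa [show 2 * (d : ℝ) * (1 / (2 * d)) = 1 by field_simp] at this

/-! ### Memory 4: the three-step block bound and `μ_4 < 2d − 1` -/

/-- Memory-`4` words have no immediate reversal and traverse no unit square (both would be coincidences at gap `2`
resp. `4`). [cite: MadrasSlade1993, §1.2 (1.2.14)] -/
theorem isMemFour_of_isMem_four {n : ℕ} {w : Fin n → Fin d × Bool} (h : IsMem 4 w) : IsMemFour w :=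
  ⟨fun k hk hrev => h k (k + 2) (by omega) (by omega) (by omega) (wordPos_add_two_of_srev w hk hrev).symm,
    fun k hk hsq => h k (k + 4) (by omega) (by omega) (by omega) (wordPos_add_four_of_square w hk hsq.1 hsq.2).symm⟩

/-- **`c_{3m+r,4}(d) ≤ (2d)^r Λ_d^m`**, `Λ_d = (2d−1)³ − 1` (`d ≥ 2`, `r ≥ 1`): the tree's three-step block bound for
memory-4 words. [cite: BDGS2012, Appendix A.1 (solution to Problem 1.2), eq. (A.4)] [cite: MadrasSlade1993, §1.2 (1.2.12)–(1.2.14)] -/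
theorem memCount_four_le (hd : 2 ≤ d) {r : ℕ} (hr : 1 ≤ r) (m : ℕ) :
    memCount d 4 (3 * m + r) ≤ (2 * d) ^ r * memFourConst d ^ m := by
  classical
  unfold memCount
  calc (memWords d 4 (3 * m + r)).card ≤ (memFourWords d (3 * m + r)).card :=
        Finset.card_le_card fun w hw => mem_memFourWords.2 (isMemFour_of_isMem_four (mem_memWords.1 hw))
    _ ≤ _ := card_memFourWords_le hd hr m

/-- **`μ_4(d)³ ≤ (2d−1)³ − 1`** for `d ≥ 2` (from `μ_4^{3m+1} ≤ c_{3m+1,4} ≤ 2d Λ_d^m` for all `m`; the argument of the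
tree's `connectiveConstant_pow_three_le`, run for `μ_4` instead of `μ`). [cite: BDGS2012, Appendix A.1, eq. (A.4)]
[cite: MadrasSlade1993, §1.2 (1.2.14)] -/
theorem memGrowth_four_pow_three_le (hd : 2 ≤ d) : memGrowth d 4 ^ 3 ≤ (2 * (d : ℝ) - 1) ^ 3 - 1 := by
  haveI : NeZero d := ⟨by omega⟩
  set μ := memGrowth d 4 with hμdef
  set Λ : ℝ := (2 * (d : ℝ) - 1) ^ 3 - 1 with hΛdef
  have hd' : (2 : ℝ) ≤ d := by exact_mod_cast hd
  have hΛpos : 0 < Λ := by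
    have h3 : (3 : ℝ) ≤ 2 * d - 1 := by linarith
    have := pow_le_pow_left₀ (by norm_num : (0 : ℝ) ≤ 3) h3 3
    rw [hΛdef]; nlinarith
  have hμpos : 0 < μ := memGrowth_pos 4
  have hcast : ((memFourConst d : ℕ) : ℝ) = Λ := by rw [hΛdef]; exact cast_memFourConst (by omega)
  have hbound : ∀ m : ℕ, μ * (μ ^ 3) ^ m ≤ 2 * d * Λ ^ m := fun m => by
    have h1 : μ ^ (3 * m + 1) ≤ memCount d 4 (3 * m + 1) := pow_memGrowth_le_memCount d 4 (3 * m)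
    have h2 : (memCount d 4 (3 * m + 1) : ℝ) ≤ 2 * d * Λ ^ m := by
      have := memCount_four_le hd (le_refl 1) m
      have hc : (memCount d 4 (3 * m + 1) : ℝ) ≤ ((2 * d) ^ 1 * memFourConst d ^ m : ℕ) := by exact_mod_cast this
      rw [Nat.cast_mul, Nat.cast_pow, Nat.cast_pow, hcast] at hc
      push_cast at hc
      linarith [hc]
    calc μ * (μ ^ 3) ^ m = μ ^ (3 * m + 1) := by ring
      _ ≤ _ := h1.trans h2
  by_contra hlt
  have hlt' : Λ < μ ^ 3 := lt_of_not_ge hlt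
  have hr : 1 < μ ^ 3 / Λ := (one_lt_div hΛpos).2 hlt'
  have hdiv : ∀ m : ℕ, (μ ^ 3 / Λ) ^ m ≤ 2 * d / μ := fun m => by
    rw [div_pow, div_le_div_iff₀ (pow_pos hΛpos m) hμpos]
    calc (μ ^ 3) ^ m * μ = μ * (μ ^ 3) ^ m := by ring
      _ ≤ 2 * d * Λ ^ m := hbound m
  have htend := tendsto_pow_atTop_atTop_of_one_lt hr
  obtain ⟨m, hm⟩ := (htend.eventually (eventually_gt_atTop (2 * d / μ))).exists
  exact absurd (hdiv m) (not_le.2 hm)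

/-- **`μ_4(d) < 2d − 1`** for every `d ≥ 2`. [cite: MadrasSlade1993, §1.2 (1.2.14) (μ₄(2) = 2.8312, μ₄(3) = 4.8645)] -/
theorem memGrowth_four_lt (hd : 2 ≤ d) : memGrowth d 4 < 2 * (d : ℝ) - 1 := by
  have h3 := memGrowth_four_pow_three_le hd
  have hμ : 0 ≤ memGrowth d 4 := memGrowth_nonneg d 4
  have hd' : (2 : ℝ) ≤ d := by exact_mod_cast hd
  by_contra hge
  have hge' : 2 * (d : ℝ) - 1 ≤ memGrowth d 4 := le_of_not_gt hge
  have := pow_le_pow_left₀ (by linarith) hge' 3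
  linarith

/-- **`μ_4(d) < μ_2(d)`**: the memory hierarchy is STRICTLY monotone at its first non-trivial rung, in every
dimension `d ≥ 2`. [cite: MadrasSlade1993, §1.2 (1.2.13)–(1.2.14)] -/
theorem memGrowth_four_lt_memGrowth_two (hd : 2 ≤ d) : memGrowth d 4 < memGrowth d 2 := by
  haveI : NeZero d := ⟨by omega⟩
  exact (memGrowth_four_lt hd).trans_le two_mul_sub_one_le_memGrowth_two

/-! ### The first rung of C4 (a), lower half: `Δ_4 > 0`, `R_4 > 0` -/

/-- **`Δ_4(d) = ln(μ_2(d)/μ_4(d)) > 0`** for every `d ≥ 2`. [folklore] -/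
theorem memLoopCost_four_pos (hd : 2 ≤ d) : 0 < memLoopCost d 4 := by
  haveI : NeZero d := ⟨by omega⟩
  unfold memLoopCost
  rw [show (4 : ℕ) - 2 = 2 from rfl]
  exact Real.log_pos ((one_lt_div (memGrowth_pos 4)).2 (memGrowth_four_lt_memGrowth_two hd))

/-- **`R_4(d) > 0` for every `d ≥ 2`**: the first rung of the lower inequality of STRUCTURE CONJ C4 (a)
(`loopCompatWindow` of …PcintLoopExclusionLaw) is a THEOREM.  (Measured: `R_4(d) = 0.586 / 0.715 / 0.780 / 0.820 / 0.848`
for `d = 2..6`; the upper inequality `R_4 < 1` and all higher rungs remain conjectural.) [folklore] -/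
theorem loopCompat_four_pos (hd : 2 ≤ d) : 0 < loopCompat d 4 := by
  haveI : NeZero d := ⟨by omega⟩
  exact div_pos (memLoopCost_four_pos hd) (memLoopDensity_even_pos hd (m := 2) le_rfl)

end Summit.CriticalPhenomena.PercolationContinuityZ3.Theorems.Pcint.MemoryTail
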